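import Summits.QuantumFields.YangMills.Theorems.FluctuationComparisonRegPrIntLS1aCellMapExtendedAverage
import Summits.QuantumFields.YangMills.Theorems.BalabanUVNodesN09ChartReadAveragingSmooth
import HarnessLib

/-!
# `FluctuationComparisonRegPrIntLS1aCellMapChartRead` — THE CHART-READ CELL MAP OF ONE UNCUT (0.4) STEP IS `C^∞` AT `0` WITH ONTO DERIVATIVE AT EVERY CONFIGURATION
# WHOSE CELL FAMILIES LIE IN THE `1∕2`-GUARD — BLOCK-TRIANGULAR ON THE CENTRAL BONDS BY LOCALITY, DIAGONAL BLOCKS INJECTIVE BY lit ✓`T4EMLTangentInjective.emlD_tangent_injective`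
# (ZERO SMALLNESS), HENCE BIJECTIVE ON THE PRIVATE DIRECTIONS: `range Dψ(0) = ⊤` AND `ker Dψ(0)` IS COMPLEMENTARY TO THE NON-PRIVATE COORDINATE SUBSPACE

Cell `ym3-torus` (HUMAN RULING D-0037: rung R3 = continuum SU(2) Yang–Mills on T³ — NOT d = 4, NOT infinite volume, NOT a mass gap, NOT Clay), WIDTH COPY «width 17»
of ym3-torus-p1, seat `ym3-torus-px17` gen 21; `--kind proof --supports stmt-QuantumFields-20520 --as helper` (count-neutral).  THEOREMS ONLY (no `def`, no `sorry`,
no `instance`, no `notation`, default heartbeats).  FILE (F5a) of the seat's 12:58Z INTENT (S1aᴴ `RunClassMembershipH` conjunct (c) at the ANCHOR heights, local-face road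
on the FULL guard): the calculus half of the face; (F5b) feeds it to ✓p823765 `…S1aSubmersionDensityFibreAE` (prescribed fibre coordinate = the non-private bonds).

WHY ∕ HOW.  pub-ymgap's ✓`…N09ChartReadAveragingSmooth` ∕ `…Submersion` read the typed averaging `avgFun` in the bond-wise exponential charts of `SU(N)` and prove `C^∞` at `0`
+ ONTO derivative on the `α ≤ 1∕24` loop window (dag-n07's Neumann-series central response).  Here the map is the CELL MAP of ✓`…S1aCellMapExtendedAverage`
(`U ↦ (c ↦ (if c ∈ s then E (loopHol U c) else 1)·U(c))`, `E` any extended average `= eml` on the `1∕2`-guard), the base configuration `U₀` is ANY field whose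
`s`-families lie in the `1∕2`-guard (large fields at `c ∉ s` allowed), and:
 §1 SMOOTHNESS — near `0` the matrix of the `c`-component of `ψ(A) = Λ(cell(Θ^B(A)·U₀)(c)·cell(U₀)(c)⁻¹)` is `log(model(e^{A}·↑U₀)(c)·↑cell(U₀)(c)⋆)` with the MODEL
    `V ↦ (if c ∈ s then avgM V c else axialM V c)` of lit ✓`Node00.AveragingSmooth` (`C^∞` where the `s`-loop matrices are in the polydisc `‖W − 1‖ < 1`): same proof as
    pub-ymgap's `contDiffAt_chartRead_avgFun`, guard `1∕2` in place of `δ_N`, `c ∈ s` in place of `Small`.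
 §2 BLOCKS — along the one-bond ray `t ↦ t·X δ_{β(c)}` the `c″`-component (`c″ ≠ c`) is CONSTANTLY `Λ 1 = 0` by LOCALITY (✓`cellMap_update_centralBond_of_ne`), so the
    off-diagonal blocks VANISH with no derivative formula; the `c`-component is `Λ(K(W_t)·K(W₀)⁻¹)`, `W_t = pre·Θ(tX)·U₀(β)·post`, `K = Kmat (offHol U₀ c) (|I|⁻¹)` on the
    window (✓`coe_cellMap_update_centralBond_self_eq_kmat`) — if its derivative vanishes then `emlD(W₀)[(pre X pre⋆)·W₀] = 0` (lit ✓`hasStrictFDerivAt_Kmat`, `D log(1) = id`),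
    whence `X = 0` by ✓`emlD_tangent_injective` (weights `|I|⁻¹ ≥ 0` of total `m∕|I| < 1`, ✓`sum_emlWeight_lt_one`; guard `< 1∕2`); for `c ∉ s` the block is `Ad_{pre}`.
 §3 LINEAR ALGEBRA — `Dψ(0)` is injective on the private subspace `ker π` (`π A := A ∘ (non-central inclusion)`), whose dimension is that of the target; so `Dψ(0)(ker π) = ⊤`,
    `range Dψ(0) = ⊤`, and `IsCompl (ker Dψ(0)) (ker π)` (disjoint + dimension count) — the three binders of ✓`exists_continuousOn_density_map_of_submersion_fibreAE`.

CONTENT — THIS FILE = §1 + §2a of three files A ⊂ B ⊂ C (≤ 400 lines each): A `…CellMapChartRead` = §1 smoothness + §2a off-diagonal blocks; B `…CellMapChartReadDiagonal`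
= §2b diagonal blocks; C `…CellMapChartReadSubmersion` = §3 linear algebra.  Namespace `Summit.QuantumFields.YangMills.Theorems.FluctuationComparisonRegPrIntLS1aCellMapChartRead`; `SU 2`; `s : Finset (PBond P (j+1))`.
§1 `eventually_window_piExpChart_translate`, `coe_cellMap_apply_eq_model`, `contDiffAt_model`, `coe_relCell_eq`, ★★`contDiffAt_chartRead_cellMap`, `measurable_chartRead_cellMap`.
§2a `chartRead_ray_apply_of_ne` (constancy), ★★`fderiv_chartRead_single_apply_of_ne` (off-diagonal blocks vanish), `chartRead_ray_apply_self`, `fibre_basePoint`, `hasDerivAt_coe_ray`.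

HONEST FRAMING.  Chart calculus over pub-ymgap's N09∕N07 files, lit `T4EMLTangentInjective`, `Node00.AveragingSmooth`, `HaarExponentialChart*`; nothing of Bałaban's analysis is
asserted or proved; S1aᴴ (c) at the anchor heights NOT closed by this file ((F4-b) px20 g22, (F5b), (F6) remain); (m), (a), S1aᴴ, the five registered stubs, crux 20520 ∕
19936 ∕ 19200 and `YM3TorusSU2` NOT proved; rung R3 = SU(2) YM₃ on T³ — NOT d = 4, NOT infinite volume, NOT a mass gap, NOT Clay; the Yang–Mills mass gap is NOT proved.
References: [Balaban1987RG1] CMP 109 (1987) (0.4) p. 253; [Helgason2000] Ch. I §1 Thm. 1.14; [EvansGariepy1992] §3.4.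
-/

set_option autoImplicit false

noncomputable section

open scoped Matrix.Norms.L2Operator Topology ENNReal Matrix
open Filter Set Function MeasureTheory

namespace Summit.QuantumFields.YangMills.Theorems.FluctuationComparisonRegPrIntLS1aCellMapChartRead

open Literature.MathematicalPhysics.QuantumFieldTheory.Balaban1983to89
open Literature.MathematicalPhysics.QuantumFieldTheory.Balaban1983to89.HaarExponentialChart
open Literature.MathematicalPhysics.QuantumFieldTheory.Balaban1983to89.HaarExponentialChart.IsChartRep
open Literature.MathematicalPhysics.QuantumFieldTheory.Balaban1983to89.BlockAveraging (Small Idx avgFun loopHol)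
open Literature.MathematicalPhysics.QuantumFieldTheory.Balaban1983to89.BlockAveragingHaarAC (centralBond IsCentral openHol pre post centralBond_injective
  loopHol_update_centralBond axialAvg_update_centralBond_of_ne axialAvg_update_centralBond)
open Literature.MathematicalPhysics.QuantumFieldTheory.Balaban1983to89.BlockAveragingEMLHaarAC (fibreFamily offHol offCard emlWeight emlWeight_nonneg sum_emlWeight_lt_one
  loopHol_update_centralBond_self coe_fibreFamily_of_not_isCentral fibreFamily_of_isCentral)
open Literature.MathematicalPhysics.QuantumFieldTheory.Balaban1983to89.ExpMeanLog (expMeanLogSU deltaSU eml)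
open Literature.MathematicalPhysics.QuantumFieldTheory.Balaban1983to89.Node00 (SU coeField avgM axialM corrM loopM contDiffAt_corrM contDiff_axialM contDiff_loopM
  coe_loopHol coe_axialAvg coe_mul_star_coe_SU star_coe_mul_coe_SU coe_inv_SU)
open Literature.MathematicalPhysics.QuantumLattice (fundamentalRep fundamentalRep_apply)
open MatrixLog (mlog analyticAt_mlog mlog_one)
open T4EMLTangentInjective (Kmat emlD hasStrictFDerivAt_Kmat emlD_tangent_injective)
open Summit.QuantumFields.YangMills.BalabanUVNodes.N09ChartReadAveragingSmooth (contDiffAt_of_coe coe_fderiv_apply_eq hasDerivAt_along_ray coe_expChart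
  coeField_piExpChart_translate piExpChart_translate_zero contDiff_coeField_piExpChart_translate piExpChart_translate_smul_single)
open Summit.QuantumFields.YangMills.Theorems.FluctuationComparisonRegPrIntLS1aCellMapExtendedAverage

variable {P : Params} {j : ℕ}
variable (E : (Idx P → SU 2) → SU 2) (s : Finset (PBond P (j + 1))) (U₀ : GaugeField P j (SU 2))

/-! ## §1 Smoothness of the chart-read cell map at `0` -/

section Smooth

/-- THE `1∕2`-WINDOW IS OPEN ALONG THE CHART: if the `s`-families of `U₀` are in the `1∕2`-guard, so are those of `Θ^B(A)·U₀` for `A` near `0`.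
[cite: Balaban1987RG1, (0.4) p.253 (bookkeeping)] -/
theorem eventually_window_piExpChart_translate
    (hwin : ∀ c ∈ s, ∀ i, ‖((loopHol U₀ c i : SU 2) : Matrix (Fin 2) (Fin 2) ℂ) - 1‖ < 1 / 2) :
    ∀ᶠ A in 𝓝 (0 : PBond P j → (specialUnitaryLogChart (Fin 2)).lie),
      ∀ c ∈ s, ∀ i, ‖((loopHol (fun b => (isChartRep_specialUnitaryGroup (n := Fin 2)).expChart (A b) * U₀ b) c i : SU 2) :
        Matrix (Fin 2) (Fin 2) ℂ) - 1‖ < 1 / 2 := by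
  have hW := contDiff_coeField_piExpChart_translate (P := P) (j := j) U₀
  have hpt : ∀ (c : PBond P (j + 1)) (i : Idx P), c ∈ s → ∀ᶠ A in 𝓝 (0 : PBond P j → (specialUnitaryLogChart (Fin 2)).lie),
      ‖loopM (coeField (fun b => (isChartRep_specialUnitaryGroup (n := Fin 2)).expChart (A b) * U₀ b)) c i - 1‖ < 1 / 2 := by
    intro c i hc
    have hcont : Continuous fun A : PBond P j → (specialUnitaryLogChart (Fin 2)).lie =>
        ‖loopM (coeField (fun b => (isChartRep_specialUnitaryGroup (n := Fin 2)).expChart (A b) * U₀ b)) c i - 1‖ :=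
      continuous_norm.comp (((contDiff_loopM c i).continuous.comp hW.continuous).sub continuous_const)
    have h0 : ‖loopM (coeField (fun b => (isChartRep_specialUnitaryGroup (n := Fin 2)).expChart
        ((0 : PBond P j → (specialUnitaryLogChart (Fin 2)).lie) b) * U₀ b)) c i - 1‖ < 1 / 2 := by
      rw [piExpChart_translate_zero, ← coe_loopHol]
      exact hwin c hc i
    exact hcont.continuousAt.eventually (isOpen_Iio.mem_nhds h0)
  have hall : ∀ᶠ A in 𝓝 (0 : PBond P j → (specialUnitaryLogChart (Fin 2)).lie), ∀ ci : {ci : PBond P (j + 1) × Idx P // ci.1 ∈ s},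
      ‖loopM (coeField (fun b => (isChartRep_specialUnitaryGroup (n := Fin 2)).expChart (A b) * U₀ b)) ci.1.1 ci.1.2 - 1‖ < 1 / 2 :=
    eventually_all.2 fun ci => hpt ci.1.1 ci.1.2 ci.2
  refine hall.mono fun A hA c hc i => ?_
  rw [coe_loopHol]
  exact hA ⟨(c, i), hc⟩

/-- ON THE WINDOW THE MATRIX OF THE CELL MAP IS THE MODEL: `↑(cell(U)(c)) = (if c ∈ s then avgM ↑U c else axialM ↑U c)` when `E = eml` on the `1∕2`-guard and the `s`-families
of `U` are in it. [cite: Balaban1987RG1, (0.4) p.253 (bookkeeping)] -/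
theorem coe_cellMap_apply_eq_model
    (hEeml : ∀ W, (∀ i, ‖((W i : SU 2) : Matrix (Fin 2) (Fin 2) ℂ) - 1‖ < 1 / 2) →
      ((E W : SU 2) : Matrix (Fin 2) (Fin 2) ℂ) = eml fun i => ((W i : SU 2) : Matrix (Fin 2) (Fin 2) ℂ))
    {U : GaugeField P j (SU 2)} (hU : ∀ c ∈ s, ∀ i, ‖((loopHol U c i : SU 2) : Matrix (Fin 2) (Fin 2) ℂ) - 1‖ < 1 / 2) (c : PBond P (j + 1)) :
    ((((if c ∈ s then E (loopHol U c) else 1) * AveragingRT.axialAvg U c : SU 2)) : Matrix (Fin 2) (Fin 2) ℂ) =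
      (if c ∈ s then avgM (coeField U) c else axialM (coeField U) c) := by
  by_cases hc : c ∈ s
  · have h1 : ((E (loopHol U c) : SU 2) : Matrix (Fin 2) (Fin 2) ℂ) = corrM (coeField U) c := by
      rw [hEeml _ (hU c hc)]
      show eml _ = eml _
      congr 1
      funext i
      exact coe_loopHol U c i
    simp only [if_pos hc, Submonoid.coe_mul, h1, coe_axialAvg, avgM]
  · simp only [if_neg hc, one_mul, coe_axialAvg]

/-- THE MODEL IS `C^∞` at every matrix field whose `s`-loop matrices lie in the polydisc `‖W − 1‖ < 1` (lit ✓`contDiffAt_corrM`, ✓`contDiff_axialM`).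
[cite: Balaban1987RG1, p.253 («we assume that it is an analytic function»)] -/
theorem contDiffAt_model {V₀ : PBond P j → Matrix (Fin 2) (Fin 2) ℂ} (hV : ∀ c ∈ s, ∀ i, ‖loopM V₀ c i - 1‖ < 1) :
    ContDiffAt ℝ ⊤ (fun (V : PBond P j → Matrix (Fin 2) (Fin 2) ℂ) (c : PBond P (j + 1)) => if c ∈ s then avgM V c else axialM V c) V₀ := by
  refine contDiffAt_pi.2 fun c => ?_
  by_cases hc : c ∈ s
  · simp only [if_pos hc]
    exact (contDiffAt_corrM c (hV c hc)).mul (contDiff_axialM c).contDiffAt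
  · simp only [if_neg hc]
    exact (contDiff_axialM c).contDiffAt

/-- On the window the matrix of the RELATIVE cell map `cell(Θ^B(A)·U₀)(c)·cell(U₀)(c)⁻¹` is `model(e^{A}·↑U₀)(c)·↑cell(U₀)(c)⋆`. [cite: Balaban1987RG1, (0.4) p.253 (bookkeeping)] -/
theorem coe_relCell_eq
    (hEeml : ∀ W, (∀ i, ‖((W i : SU 2) : Matrix (Fin 2) (Fin 2) ℂ) - 1‖ < 1 / 2) →
      ((E W : SU 2) : Matrix (Fin 2) (Fin 2) ℂ) = eml fun i => ((W i : SU 2) : Matrix (Fin 2) (Fin 2) ℂ))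
    {A : PBond P j → (specialUnitaryLogChart (Fin 2)).lie} (c : PBond P (j + 1))
    (hA : ∀ c ∈ s, ∀ i, ‖((loopHol (fun b => (isChartRep_specialUnitaryGroup (n := Fin 2)).expChart (A b) * U₀ b) c i : SU 2) :
      Matrix (Fin 2) (Fin 2) ℂ) - 1‖ < 1 / 2) :
    ((((if c ∈ s then E (loopHol (fun b => (isChartRep_specialUnitaryGroup (n := Fin 2)).expChart (A b) * U₀ b) c) else 1) *
          AveragingRT.axialAvg (fun b => (isChartRep_specialUnitaryGroup (n := Fin 2)).expChart (A b) * U₀ b) c *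
        ((if c ∈ s then E (loopHol U₀ c) else 1) * AveragingRT.axialAvg U₀ c)⁻¹ : SU 2)) : Matrix (Fin 2) (Fin 2) ℂ) =
      (if c ∈ s then avgM (coeField (fun b => (isChartRep_specialUnitaryGroup (n := Fin 2)).expChart (A b) * U₀ b)) c
        else axialM (coeField (fun b => (isChartRep_specialUnitaryGroup (n := Fin 2)).expChart (A b) * U₀ b)) c) *
        star ((((if c ∈ s then E (loopHol U₀ c) else 1) * AveragingRT.axialAvg U₀ c : SU 2)) : Matrix (Fin 2) (Fin 2) ℂ) := by
  rw [Submonoid.coe_mul, coe_inv_SU, coe_cellMap_apply_eq_model E s hEeml hA c]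

/-- ★★ **THE CHART-READ CELL MAP IS `C^∞` AT `0`** at every `U₀` whose `s`-families lie in the `1∕2`-guard: near `0` its matrix is `log(model(e^{A}·↑U₀)(c)·↑cell(U₀)(c)⋆)` with the
model `C^∞` and `log` analytic at `1`. [cite: Balaban1987RG1, (0.4) p.253, p.253 («we assume that it is an analytic function»); Helgason2000, Ch. I §1 Thm. 1.14] -/
theorem contDiffAt_chartRead_cellMap
    (hEeml : ∀ W, (∀ i, ‖((W i : SU 2) : Matrix (Fin 2) (Fin 2) ℂ) - 1‖ < 1 / 2) →
      ((E W : SU 2) : Matrix (Fin 2) (Fin 2) ℂ) = eml fun i => ((W i : SU 2) : Matrix (Fin 2) (Fin 2) ℂ))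
    (hwin : ∀ c ∈ s, ∀ i, ‖((loopHol U₀ c i : SU 2) : Matrix (Fin 2) (Fin 2) ℂ) - 1‖ < 1 / 2) :
    ContDiffAt ℝ ⊤ (fun (A : PBond P j → (specialUnitaryLogChart (Fin 2)).lie) (c : PBond P (j + 1)) =>
      (isChartRep_specialUnitaryGroup (n := Fin 2)).logChart
        ((if c ∈ s then E (loopHol (fun b => (isChartRep_specialUnitaryGroup (n := Fin 2)).expChart (A b) * U₀ b) c) else 1) *
            AveragingRT.axialAvg (fun b => (isChartRep_specialUnitaryGroup (n := Fin 2)).expChart (A b) * U₀ b) c *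
          ((if c ∈ s then E (loopHol U₀ c) else 1) * AveragingRT.axialAvg U₀ c)⁻¹)) 0 := by
  set h := isChartRep_specialUnitaryGroup (n := Fin 2) with hh
  set W : (PBond P j → (specialUnitaryLogChart (Fin 2)).lie) → PBond P j → Matrix (Fin 2) (Fin 2) ℂ :=
    fun A => coeField (fun b => h.expChart (A b) * U₀ b) with hWdef
  have hW : ContDiff ℝ ⊤ W := contDiff_coeField_piExpChart_translate (P := P) (j := j) U₀
  have hW0 : W 0 = coeField U₀ := by
    show coeField (fun b => h.expChart ((0 : PBond P j → (specialUnitaryLogChart (Fin 2)).lie) b) * U₀ b) = coeField U₀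
    rw [piExpChart_translate_zero]
  have hwinA := eventually_window_piExpChart_translate (P := P) (j := j) s U₀ hwin
  have hV0 : ∀ c ∈ s, ∀ i, ‖loopM (W 0) c i - 1‖ < 1 := fun c hc i => by
    rw [hW0, ← coe_loopHol]; exact (hwin c hc i).trans (by norm_num)
  refine contDiffAt_pi.2 fun c => ?_
  refine contDiffAt_of_coe (specialUnitaryLogChart (Fin 2)).lie ?_
  set g : Matrix (Fin 2) (Fin 2) ℂ := star ((((if c ∈ s then E (loopHol U₀ c) else 1) * AveragingRT.axialAvg U₀ c : SU 2)) : Matrix (Fin 2) (Fin 2) ℂ) with hg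
  -- the smooth model of the `c`-component
  have h1 : ContDiffAt ℝ ⊤ (fun A : PBond P j → (specialUnitaryLogChart (Fin 2)).lie => (if c ∈ s then avgM (W A) c else axialM (W A) c)) 0 := by
    have ha := contDiffAt_model (P := P) (j := j) s (V₀ := W 0) hV0
    exact (contDiffAt_pi.1 (ha.comp 0 hW.contDiffAt)) c
  have h2 : ContDiffAt ℝ ⊤ (fun A : PBond P j → (specialUnitaryLogChart (Fin 2)).lie => (if c ∈ s then avgM (W A) c else axialM (W A) c) * g) 0 :=
    h1.mul contDiffAt_const
  have hval : (if c ∈ s then avgM (W 0) c else axialM (W 0) c) * g = 1 := by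
    rw [hW0, ← coe_cellMap_apply_eq_model E s hEeml hwin c, hg, coe_mul_star_coe_SU]
  have h3 : ContDiffAt ℝ ⊤ (mlog : Matrix (Fin 2) (Fin 2) ℂ → Matrix (Fin 2) (Fin 2) ℂ) ((if c ∈ s then avgM (W 0) c else axialM (W 0) c) * g) := by
    rw [hval]; exact ((analyticAt_mlog (by simp)).contDiffAt).restrict_scalars ℝ
  have hΦ : ContDiffAt ℝ ⊤ (fun A : PBond P j → (specialUnitaryLogChart (Fin 2)).lie => mlog ((if c ∈ s then avgM (W A) c else axialM (W A) c) * g)) 0 :=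
    ContDiffAt.comp (g := (mlog : Matrix (Fin 2) (Fin 2) ℂ → Matrix (Fin 2) (Fin 2) ℂ))
      (f := fun A : PBond P j → (specialUnitaryLogChart (Fin 2)).lie => (if c ∈ s then avgM (W A) c else axialM (W A) c) * g) 0 h3 h2
  have hnear : ∀ᶠ A in 𝓝 (0 : PBond P j → (specialUnitaryLogChart (Fin 2)).lie),
      ‖(if c ∈ s then avgM (W A) c else axialM (W A) c) * g - 1‖ < innerRadius (specialUnitaryLogChart (Fin 2)) := by
    have hc : ContinuousAt (fun A : PBond P j → (specialUnitaryLogChart (Fin 2)).lie => ‖(if c ∈ s then avgM (W A) c else axialM (W A) c) * g - 1‖) 0 :=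
      continuous_norm.continuousAt.comp (h2.continuousAt.sub continuousAt_const)
    refine hc.eventually (isOpen_Iio.mem_nhds ?_)
    show ‖(if c ∈ s then avgM (W 0) c else axialM (W 0) c) * g - 1‖ < innerRadius (specialUnitaryLogChart (Fin 2))
    rw [hval, sub_self, norm_zero]; exact innerRadius_pos
  refine hΦ.congr_of_eventuallyEq ((hwinA.and hnear).mono fun A hA => ?_)
  obtain ⟨hAwin, hAnear⟩ := hA
  have hcoe := coe_relCell_eq E s U₀ hEeml c hAwin
  have hρ : ‖fundamentalRep (Fin 2)
      ((if c ∈ s then E (loopHol (fun b => h.expChart (A b) * U₀ b) c) else 1) * AveragingRT.axialAvg (fun b => h.expChart (A b) * U₀ b) c *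
        ((if c ∈ s then E (loopHol U₀ c) else 1) * AveragingRT.axialAvg U₀ c)⁻¹) - 1‖ < innerRadius (specialUnitaryLogChart (Fin 2)) := by
    rw [fundamentalRep_apply, hcoe]; exact hAnear
  show ((h.logChart ((if c ∈ s then E (loopHol (fun b => h.expChart (A b) * U₀ b) c) else 1) * AveragingRT.axialAvg (fun b => h.expChart (A b) * U₀ b) c *
      ((if c ∈ s then E (loopHol U₀ c) else 1) * AveragingRT.axialAvg U₀ c)⁻¹) : (specialUnitaryLogChart (Fin 2)).lie) : Matrix (Fin 2) (Fin 2) ℂ) =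
    mlog ((if c ∈ s then avgM (W A) c else axialM (W A) c) * g)
  rw [h.coe_logChart hρ, fundamentalRep_apply, hcoe]

variable [MeasurableSpace (specialUnitaryLogChart (Fin 2)).lie] [BorelSpace (specialUnitaryLogChart (Fin 2)).lie]

/-- The chart-read cell map is Borel measurable (for a measurable `E`). [cite: Balaban1987RG1, (0.4) p.253 (bookkeeping)] -/
theorem measurable_chartRead_cellMap (hEm : Measurable E) :
    Measurable (fun (A : PBond P j → (specialUnitaryLogChart (Fin 2)).lie) (c : PBond P (j + 1)) =>
      (isChartRep_specialUnitaryGroup (n := Fin 2)).logChart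
        ((if c ∈ s then E (loopHol (fun b => (isChartRep_specialUnitaryGroup (n := Fin 2)).expChart (A b) * U₀ b) c) else 1) *
            AveragingRT.axialAvg (fun b => (isChartRep_specialUnitaryGroup (n := Fin 2)).expChart (A b) * U₀ b) c *
          ((if c ∈ s then E (loopHol U₀ c) else 1) * AveragingRT.axialAvg U₀ c)⁻¹)) := by
  set h := isChartRep_specialUnitaryGroup (n := Fin 2) with hh
  have hΘ : Measurable (fun (A : PBond P j → (specialUnitaryLogChart (Fin 2)).lie) (b : PBond P j) => h.expChart (A b) * U₀ b) :=
    measurable_pi_lambda _ fun b => (h.continuous_expChart.measurable.comp (measurable_pi_apply b)).mul_const _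
  have hM := measurable_cellMap (P := P) (j := j) E s hEm
  refine measurable_pi_lambda _ fun c => ?_
  exact h.measurable_logChart.comp (((measurable_pi_apply c).comp (hM.comp hΘ)).mul_const _)

end Smooth

/-! ## §2 The blocks of `Dψ(0)` on the central bonds: off-diagonal ZERO by locality, diagonal INJECTIVE by `emlD_tangent_injective` -/

section Blocks

/-- LOCALITY ALONG THE RAY: for `c″ ≠ c` the `c″`-component of the chart-read cell map is CONSTANTLY `Λ 1 = 0` along `t ↦ t·X δ_{β(c)}` (the translate is the one-bond update at
`β(c)`, invisible to the cell map's `c″`-component, ✓`cellMap_update_centralBond_of_ne`). [cite: Balaban1987RG1, (0.4) p.253; Balaban1985Averaging, p.19 (locality)] -/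
theorem chartRead_ray_apply_of_ne (hj : j + 1 ≤ P.m + P.K) {c c'' : PBond P (j + 1)} (hc : c'' ≠ c) (X : (specialUnitaryLogChart (Fin 2)).lie) (t : ℝ) :
    (isChartRep_specialUnitaryGroup (n := Fin 2)).logChart
        ((if c'' ∈ s then E (loopHol (fun b => (isChartRep_specialUnitaryGroup (n := Fin 2)).expChart
            ((t • (Pi.single (centralBond c) X : PBond P j → (specialUnitaryLogChart (Fin 2)).lie)) b) * U₀ b) c'') else 1) *
            AveragingRT.axialAvg (fun b => (isChartRep_specialUnitaryGroup (n := Fin 2)).expChart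
              ((t • (Pi.single (centralBond c) X : PBond P j → (specialUnitaryLogChart (Fin 2)).lie)) b) * U₀ b) c'' *
          ((if c'' ∈ s then E (loopHol U₀ c'') else 1) * AveragingRT.axialAvg U₀ c'')⁻¹) = 0 := by
  have hΘ := piExpChart_translate_smul_single (P := P) (j := j) U₀ (centralBond c) X t
  have key : ∀ V : GaugeField P j (SU 2), V = Function.update U₀ (centralBond c)
      ((isChartRep_specialUnitaryGroup (n := Fin 2)).expChart (t • X) * U₀ (centralBond c)) →
      (isChartRep_specialUnitaryGroup (n := Fin 2)).logChart
        ((if c'' ∈ s then E (loopHol V c'') else 1) * AveragingRT.axialAvg V c'' *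
          ((if c'' ∈ s then E (loopHol U₀ c'') else 1) * AveragingRT.axialAvg U₀ c'')⁻¹) = 0 := by
    rintro V rfl
    rw [cellMap_update_centralBond_of_ne E s hj U₀ c c'' hc, mul_inv_cancel, logChart_one]
  exact key _ hΘ

/-- ★★ **THE OFF-DIAGONAL BLOCKS VANISH**: `(Dψ(0)[X δ_{β(c)}])(c″) = 0` for `c″ ≠ c` — the derivative along a ray of a constant (given differentiability of `ψ` at `0`, §1).
[cite: Balaban1987RG1, (0.4) p.253; Balaban1985Averaging, p.19 (locality)] -/
theorem fderiv_chartRead_single_apply_of_ne (hj : j + 1 ≤ P.m + P.K)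
    (hEeml : ∀ W, (∀ i, ‖((W i : SU 2) : Matrix (Fin 2) (Fin 2) ℂ) - 1‖ < 1 / 2) →
      ((E W : SU 2) : Matrix (Fin 2) (Fin 2) ℂ) = eml fun i => ((W i : SU 2) : Matrix (Fin 2) (Fin 2) ℂ))
    (hwin : ∀ c ∈ s, ∀ i, ‖((loopHol U₀ c i : SU 2) : Matrix (Fin 2) (Fin 2) ℂ) - 1‖ < 1 / 2)
    {c c'' : PBond P (j + 1)} (hc : c'' ≠ c) (X : (specialUnitaryLogChart (Fin 2)).lie) :
    fderiv ℝ (fun (A : PBond P j → (specialUnitaryLogChart (Fin 2)).lie) (c : PBond P (j + 1)) =>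
      (isChartRep_specialUnitaryGroup (n := Fin 2)).logChart
        ((if c ∈ s then E (loopHol (fun b => (isChartRep_specialUnitaryGroup (n := Fin 2)).expChart (A b) * U₀ b) c) else 1) *
            AveragingRT.axialAvg (fun b => (isChartRep_specialUnitaryGroup (n := Fin 2)).expChart (A b) * U₀ b) c *
          ((if c ∈ s then E (loopHol U₀ c) else 1) * AveragingRT.axialAvg U₀ c)⁻¹)) 0
      (Pi.single (centralBond c) X) c'' = 0 := by
  set ψ := fun (A : PBond P j → (specialUnitaryLogChart (Fin 2)).lie) (c : PBond P (j + 1)) =>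
      (isChartRep_specialUnitaryGroup (n := Fin 2)).logChart
        ((if c ∈ s then E (loopHol (fun b => (isChartRep_specialUnitaryGroup (n := Fin 2)).expChart (A b) * U₀ b) c) else 1) *
            AveragingRT.axialAvg (fun b => (isChartRep_specialUnitaryGroup (n := Fin 2)).expChart (A b) * U₀ b) c *
          ((if c ∈ s then E (loopHol U₀ c) else 1) * AveragingRT.axialAvg U₀ c)⁻¹) with hψ
  set a : PBond P j → (specialUnitaryLogChart (Fin 2)).lie := Pi.single (centralBond c) X with ha
  have hdiff : DifferentiableAt ℝ ψ 0 := (contDiffAt_chartRead_cellMap (P := P) (j := j) E s U₀ hEeml hwin).differentiableAt (by simp)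
  have hcompF : HasFDerivAt (fun A => ψ A c'') ((ContinuousLinearMap.proj c'').comp (fderiv ℝ ψ 0)) 0 :=
    (hasFDerivAt_pi' (Φ := ψ) (Φ' := fderiv ℝ ψ 0) (x := (0 : PBond P j → (specialUnitaryLogChart (Fin 2)).lie))).1 hdiff.hasFDerivAt c''
  have hpi : fderiv ℝ ψ 0 a c'' = fderiv ℝ (fun A => ψ A c'') 0 a := by rw [hcompF.fderiv]; rfl
  rw [hpi]
  -- along the ray the component is constantly `0`
  have hray : HasDerivAt (fun t : ℝ => ψ (t • a) c'') (fderiv ℝ (fun A => ψ A c'') 0 a) 0 := hasDerivAt_along_ray hcompF.differentiableAt a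
  have hconst : (fun t : ℝ => ψ (t • a) c'') = fun _ => 0 := funext fun t => chartRead_ray_apply_of_ne E s U₀ hj hc X t
  rw [hconst] at hray
  exact (hasDerivAt_const (0 : ℝ) (0 : (specialUnitaryLogChart (Fin 2)).lie)).unique hray |>.symm

/-- THE DIAGONAL RAY IN THE PRIVATE COORDINATE: along `t ↦ t·X δ_{β(c)}` the `c`-component is `Λ(F_c(W_t)·F_c(W₀)⁻¹)` with `W_t = pre·Θ(tX)·U₀(β(c))·post` and
`F_c(W) = (if c ∈ s then E (fibreFamily U₀ c W) else 1)·W` (✓`cellMap_update_centralBond_self`). [cite: Balaban1987RG1, (0.4) p.253 (bookkeeping)] -/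
theorem chartRead_ray_apply_self (hj : j + 1 ≤ P.m + P.K) (c : PBond P (j + 1)) (X : (specialUnitaryLogChart (Fin 2)).lie) (t : ℝ) :
    (isChartRep_specialUnitaryGroup (n := Fin 2)).logChart
        ((if c ∈ s then E (loopHol (fun b => (isChartRep_specialUnitaryGroup (n := Fin 2)).expChart
            ((t • (Pi.single (centralBond c) X : PBond P j → (specialUnitaryLogChart (Fin 2)).lie)) b) * U₀ b) c) else 1) *
            AveragingRT.axialAvg (fun b => (isChartRep_specialUnitaryGroup (n := Fin 2)).expChart
              ((t • (Pi.single (centralBond c) X : PBond P j → (specialUnitaryLogChart (Fin 2)).lie)) b) * U₀ b) c *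
          ((if c ∈ s then E (loopHol U₀ c) else 1) * AveragingRT.axialAvg U₀ c)⁻¹) =
      (isChartRep_specialUnitaryGroup (n := Fin 2)).logChart
        ((if c ∈ s then E (fibreFamily U₀ c (pre U₀ c * ((isChartRep_specialUnitaryGroup (n := Fin 2)).expChart (t • X) * U₀ (centralBond c)) * post U₀ c)) else 1) *
            (pre U₀ c * ((isChartRep_specialUnitaryGroup (n := Fin 2)).expChart (t • X) * U₀ (centralBond c)) * post U₀ c) *
          ((if c ∈ s then E (loopHol U₀ c) else 1) * AveragingRT.axialAvg U₀ c)⁻¹) := by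
  have hΘ := piExpChart_translate_smul_single (P := P) (j := j) U₀ (centralBond c) X t
  have key : ∀ V : GaugeField P j (SU 2), V = Function.update U₀ (centralBond c)
      ((isChartRep_specialUnitaryGroup (n := Fin 2)).expChart (t • X) * U₀ (centralBond c)) →
      (isChartRep_specialUnitaryGroup (n := Fin 2)).logChart
        ((if c ∈ s then E (loopHol V c) else 1) * AveragingRT.axialAvg V c *
          ((if c ∈ s then E (loopHol U₀ c) else 1) * AveragingRT.axialAvg U₀ c)⁻¹) =
      (isChartRep_specialUnitaryGroup (n := Fin 2)).logChart
        ((if c ∈ s then E (fibreFamily U₀ c (pre U₀ c * ((isChartRep_specialUnitaryGroup (n := Fin 2)).expChart (t • X) * U₀ (centralBond c)) * post U₀ c)) else 1) *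
            (pre U₀ c * ((isChartRep_specialUnitaryGroup (n := Fin 2)).expChart (t • X) * U₀ (centralBond c)) * post U₀ c) *
          ((if c ∈ s then E (loopHol U₀ c) else 1) * AveragingRT.axialAvg U₀ c)⁻¹) := by
    rintro V rfl
    rw [cellMap_update_centralBond_self E s hj U₀ c]
  exact key _ hΘ

/-- The base point of the private coordinate: `pre·U₀(β(c))·post = U₀(c)` (`axialAvg`, lit ✓`axialAvg_eq_pre_mul_mul_post`), and `fibreFamily U₀ c (U₀(c)) = loopHol U₀ c`
(`loopHol = openHol · U(c)⁻¹`, central open holonomies `= U(c)`). [cite: Balaban1987RG1, (0.4) p.253 (bookkeeping)] -/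
theorem fibre_basePoint (c : PBond P (j + 1)) :
    pre U₀ c * U₀ (centralBond c) * post U₀ c = AveragingRT.axialAvg U₀ c ∧
      fibreFamily U₀ c (AveragingRT.axialAvg U₀ c) = loopHol U₀ c := by
  refine ⟨(BlockAveragingHaarAC.axialAvg_eq_pre_mul_mul_post U₀ c).symm, funext fun i => ?_⟩
  by_cases hi : IsCentral c i
  · rw [fibreFamily_of_isCentral _ _ _ _ hi, BlockAveragingHaarAC.loopHol_eq_openHol_mul, BlockAveragingHaarAC.openHol_of_isCentral _ _ _ hi,
      mul_inv_cancel]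
  · rw [BlockAveragingEMLHaarAC.fibreFamily_of_not_isCentral _ _ _ _ hi, BlockAveragingHaarAC.loopHol_eq_openHol_mul]

/-- THE COERCED RAY DERIVATIVE (generic): for `ψ` differentiable at `0`, the matrix of the `c`-component along `t ↦ t·a` has derivative the matrix of `(Dψ(0) a)(c)` at `t = 0`.
[cite: Balaban1985RegularSpaces, (1.10) p.77 (bookkeeping)] -/
theorem hasDerivAt_coe_ray {ψ : (PBond P j → (specialUnitaryLogChart (Fin 2)).lie) → PBond P (j + 1) → (specialUnitaryLogChart (Fin 2)).lie}
    (hψ : DifferentiableAt ℝ ψ 0) (a : PBond P j → (specialUnitaryLogChart (Fin 2)).lie) (c : PBond P (j + 1)) :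
    HasDerivAt (fun t : ℝ => ((ψ (t • a) c : (specialUnitaryLogChart (Fin 2)).lie) : Matrix (Fin 2) (Fin 2) ℂ))
      ((fderiv ℝ ψ 0 a c : (specialUnitaryLogChart (Fin 2)).lie) : Matrix (Fin 2) (Fin 2) ℂ) 0 := by
  have hcompF : HasFDerivAt (fun A => ψ A c) ((ContinuousLinearMap.proj c).comp (fderiv ℝ ψ 0)) 0 :=
    (hasFDerivAt_pi' (Φ := ψ) (Φ' := fderiv ℝ ψ 0) (x := (0 : PBond P j → (specialUnitaryLogChart (Fin 2)).lie))).1 hψ.hasFDerivAt c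
  have hpi : fderiv ℝ ψ 0 a c = fderiv ℝ (fun A => ψ A c) 0 a := by rw [hcompF.fderiv]; rfl
  have hcoediff : DifferentiableAt ℝ (fun A : PBond P j → (specialUnitaryLogChart (Fin 2)).lie =>
      ((ψ A c : (specialUnitaryLogChart (Fin 2)).lie) : Matrix (Fin 2) (Fin 2) ℂ)) 0 :=
    ((specialUnitaryLogChart (Fin 2)).lie.subtypeL.differentiableAt).comp (0 : PBond P j → (specialUnitaryLogChart (Fin 2)).lie) hcompF.differentiableAt
  have h1 := hasDerivAt_along_ray hcoediff a
  rwa [← coe_fderiv_apply_eq _ hcompF.differentiableAt a, ← hpi] at h1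

end Blocks

end Summit.QuantumFields.YangMills.Theorems.FluctuationComparisonRegPrIntLS1aCellMapChartRead

end
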